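import Summits.CriticalPhenomena.CardyFormulaZ2.Theses.CardyRotToConf
import Literature.Probability.RandomPlanarGeometry.BoundaryCorrespondence
import Literature.Probability.RandomPlanarGeometry.ConformalMapCaratheodoryProofs
import HarnessLib

/-!
# Chordal SLE reaches its target only at the end
# (line `germ-label-transport`, crux `stmt-CriticalPhenomena-0698`)

Stub `stub_sleNoEarlyTarget` of the lead's skeleton: for a chordal SLE_κ law `μ` of a Dobrushin
domain `(D; a, b)` (any `κ`), `μ`-a.e. curve class `γ` satisfies: for EVERY representative `c` of
`γ` and all parameters `s ≤ t`, `c s = b → c t = b` — once a representative is at the target it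
stays there (a representative may idle at `b` on a final parameter interval, but never visits `b`
and leaves it). Used by the fat-germ one-shot surgery: its Markov kernel declares the future to be
the constant curve at `b` when the tip of a stopped past is `b`.

Proof.
* The special representative `c₀` of the class of an SLE curve (`IsSLECurve`: `c₀ s = Φ(γ(s/(1-s)))`
  for `s < 1`, `c₀ 1 = b`, `Φ` the boundary extension of a chordal uniformizing map, `γ` the trace
  in `ℍ̄`) takes the value `b` ONLY at parameter `1`: `Φ z ≠ b` on `ℍ̄`
  (`MarkedDomain.boundaryExtension_ne_pt_one`, Carathéodory `exists_continuousOn_extension_holds`).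
* Transfer to every representative `c`, `dist c c₀ = 0` (`curve_apply_eq_of_dist_eq_zero`): along
  sup-close reparametrisations `φₙ` (`‖c - c₀ ∘ φₙ‖ → 0`) a subsequential limit `(s', t')` of
  `(φₙ s, φₙ t)` has `c₀ s' = c s = b`, so `s' = 1`, so `t' = 1` and `c t = c₀ t' = b`.
* Transport to the law (`ae_map_iff`): the complementary event "some representative visits `b` and
  is later off `b`" is Borel — the countable union over `ε = 1/(n+1)` of the CLOSED events
  `isClosed_setOf_visits_then_dist_ge` (closedness along sup-close reparametrisations
  and a convergent subsequence of witnesses, as for the tracing events of `SLENoTracedLine`).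

References: S. Rohde, O. Schramm, *Basic properties of SLE*, Ann. of Math. 161 (2005), Thm 7.1
(transience: the trace reaches `∞`, i.e. `b`, only in the limit); M. Aizenman, A. Burchard, Duke
Math. J. 99 (1999), §2.1 (curve space).
-/

noncomputable section

open Set Filter Topology MeasureTheory Metric
open scoped unitInterval NNReal

namespace Summit.CriticalPhenomena.CardyFormulaZ2.Theorems.CardyRotToConfR2SymmetryUpgrade

open Literature.Probability.RandomPlanarGeometry MeasureTheory

section CurveClass

variable {E : Type*} [MetricSpace E]

/-- **Evaluation along sup-close reparametrisations.** If `dist (c w) (c' n (φ n w)) < δ n` for all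
`n, w` with `δ → 0` along `ψ`, then `c' (ψ k) (φ (ψ k) (w k)) → c w₀` whenever `w k → w₀`.
[cite: AizenmanBurchard1999, §2.1] -/
theorem tendsto_apply_reparam_of_dist_lt {c : Curve E} {c' : ℕ → Curve E}
    {φ : ℕ → I ≃o I} {δ : ℕ → ℝ} (hpt : ∀ n (w : I), dist (c w) (c' n (φ n w)) < δ n)
    {ψ : ℕ → ℕ} (hδ : Tendsto (fun k ↦ δ (ψ k)) atTop (𝓝 0)) {w : ℕ → I} {w₀ : I}
    (hw : Tendsto w atTop (𝓝 w₀)) :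
    Tendsto (fun k ↦ c' (ψ k) (φ (ψ k) (w k))) atTop (𝓝 (c w₀)) := by
  rw [tendsto_iff_dist_tendsto_zero]
  have h1 : Tendsto (fun k ↦ dist (c (w k)) (c w₀)) atTop (𝓝 0) :=
    tendsto_iff_dist_tendsto_zero.1 ((c.continuous.tendsto w₀).comp hw)
  refine squeeze_zero (fun _ ↦ dist_nonneg) (fun k ↦ ?_) (by simpa using hδ.add h1)
  calc dist (c' (ψ k) (φ (ψ k) (w k))) (c w₀)
      ≤ dist (c' (ψ k) (φ (ψ k) (w k))) (c (w k)) + dist (c (w k)) (c w₀) := dist_triangle _ _ _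
    _ ≤ δ (ψ k) + dist (c (w k)) (c w₀) := by
        gcongr
        rw [dist_comm]
        exact (hpt (ψ k) (w k)).le

/-- **Final values are class invariants.** If the curve `c₀` takes the value `b` only at the final
parameter `1` (and does take it there), then every curve `c` at reparametrisation distance `0` from
`c₀` stays at `b` after any visit of `b`: `c s = b`, `s ≤ t` imply `c t = b`.
[cite: AizenmanBurchard1999, §2.1] -/
theorem curve_apply_eq_of_dist_eq_zero {c c₀ : Curve E} {b : E} (h : dist c c₀ = 0)
    (hb : ∀ u : I, c₀ u = b → u = 1) (h1 : c₀ 1 = b) {s t : I} (hst : s ≤ t) (hs : c s = b) :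
    c t = b := by
  -- reparametrisations `φ n` with sup distance `< 1/(n+1)`
  have hex : ∀ n : ℕ, ∃ φ : I ≃o I,
      dist c.toContinuousMap (c₀.reparam φ).toContinuousMap < 1 / ((n : ℝ) + 1) := fun n ↦
    Curve.exists_dist_reparam_lt (by rw [h]; positivity)
  choose φ hφ using hex
  have hpt : ∀ n (w : I), dist (c w) (c₀ (φ n w)) < 1 / ((n : ℝ) + 1) := fun n w ↦
    (ContinuousMap.dist_apply_le_dist (f := c.toContinuousMap)
      (g := (c₀.reparam (φ n)).toContinuousMap) w).trans_lt (hφ n)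
  -- a subsequence along which `(φ n s, φ n t)` converges
  obtain ⟨⟨s', t'⟩, ψ, hψ, hlim⟩ := CompactSpace.tendsto_subseq fun n ↦ (φ n s, φ n t)
  have hs' : Tendsto (fun k ↦ φ (ψ k) s) atTop (𝓝 s') := hlim.fst_nhds
  have ht' : Tendsto (fun k ↦ φ (ψ k) t) atTop (𝓝 t') := hlim.snd_nhds
  have hδ : Tendsto (fun k ↦ 1 / (((ψ k : ℕ) : ℝ) + 1)) atTop (𝓝 0) :=
    tendsto_one_div_add_atTop_nhds_zero_nat.comp hψ.tendsto_atTop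
  have hkey : ∀ {w : ℕ → I} {w₀ : I}, Tendsto w atTop (𝓝 w₀) →
      Tendsto (fun k ↦ c₀ (φ (ψ k) (w k))) atTop (𝓝 (c w₀)) := fun hw ↦
    tendsto_apply_reparam_of_dist_lt (c' := fun _ ↦ c₀) (δ := fun n : ℕ ↦ 1 / ((n : ℝ) + 1))
      hpt hδ hw
  -- `c₀ s' = c s = b`, hence `s' = 1`, hence `t' = 1`
  have hcs' : c₀ s' = c s :=
    tendsto_nhds_unique ((c₀.continuous.tendsto s').comp hs') (hkey (w₀ := s) tendsto_const_nhds)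
  have hs'1 : s' = 1 := hb s' (hcs'.trans hs)
  have hle : s' ≤ t' := le_of_tendsto_of_tendsto' hs' ht' fun k ↦ (φ (ψ k)).monotone hst
  have ht'1 : t' = 1 := le_antisymm unitInterval.le_one' (hs'1.symm.le.trans hle)
  -- `c t = c₀ t' = b`
  have hct' : c₀ t' = c t :=
    tendsto_nhds_unique ((c₀.continuous.tendsto t').comp ht') (hkey (w₀ := t) tendsto_const_nhds)
  rw [← hct', ht'1, h1]

/-- **The quantitative "visits `b`, later `ε`-off `b`" event is closed**: curve classes with a
representative `c` and parameters `s ≤ t` such that `c s = b` and `ε ≤ dist (c t) b`.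
[cite: AizenmanBurchard1999, §2.1] -/
theorem isClosed_setOf_visits_then_dist_ge (b : E) (ε : ℝ) :
    IsClosed {γ : CurveClass E | ∃ c : Curve E, CurveClass.mk c = γ ∧ ∃ s t : I, s ≤ t ∧
      c s = b ∧ ε ≤ dist (c t) b} := by
  refine IsSeqClosed.isClosed fun x γ hx hlim ↦ ?_
  obtain ⟨c, rfl⟩ := CurveClass.surjective_mk γ
  choose c' hmk s t hst hsb hε using hx
  -- sup-close reparametrisations of the representatives `c' n`
  have hdist : Tendsto (fun n ↦ dist c (c' n)) atTop (𝓝 0) := by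
    refine (tendsto_iff_dist_tendsto_zero.1 hlim).congr fun n ↦ ?_
    rw [← hmk n, CurveClass.dist_mk_mk, dist_comm]
  set δ : ℕ → ℝ := fun n ↦ dist c (c' n) + 1 / ((n : ℝ) + 1) with hδ
  have hδlim : Tendsto δ atTop (𝓝 0) := by
    have h := hdist.add tendsto_one_div_add_atTop_nhds_zero_nat
    rw [add_zero] at h
    exact h
  have hex : ∀ n, ∃ φ : I ≃o I,
      dist c.toContinuousMap ((c' n).reparam φ).toContinuousMap < δ n := fun n ↦
    Curve.exists_dist_reparam_lt (lt_add_of_pos_right _ (by positivity))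
  choose φ hφ using hex
  have hpt : ∀ n (w : I), dist (c w) (c' n (φ n w)) < δ n := fun n w ↦
    (ContinuousMap.dist_apply_le_dist (f := c.toContinuousMap)
      (g := ((c' n).reparam (φ n)).toContinuousMap) w).trans_lt (hφ n)
  -- pulled-back witnesses and a convergent subsequence in `[0, 1]²`
  set s' : ℕ → I := fun n ↦ (φ n).symm (s n) with hs'
  set t' : ℕ → I := fun n ↦ (φ n).symm (t n) with ht'
  have hφs : ∀ n, φ n (s' n) = s n := fun n ↦ (φ n).apply_symm_apply _
  have hφt : ∀ n, φ n (t' n) = t n := fun n ↦ (φ n).apply_symm_apply _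
  have hs't' : ∀ n, s' n ≤ t' n := fun n ↦ (φ n).symm.monotone (hst n)
  obtain ⟨⟨s₀, t₀⟩, ψ, hψ, hlim'⟩ := CompactSpace.tendsto_subseq fun n ↦ (s' n, t' n)
  have hs₀ : Tendsto (fun k ↦ s' (ψ k)) atTop (𝓝 s₀) := hlim'.fst_nhds
  have ht₀ : Tendsto (fun k ↦ t' (ψ k)) atTop (𝓝 t₀) := hlim'.snd_nhds
  have hkey : ∀ {w : ℕ → I} {w₀ : I}, Tendsto w atTop (𝓝 w₀) →
      Tendsto (fun k ↦ c' (ψ k) (φ (ψ k) (w k))) atTop (𝓝 (c w₀)) := fun hw ↦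
    tendsto_apply_reparam_of_dist_lt hpt (hδlim.comp hψ.tendsto_atTop) hw
  -- the limit witnesses
  have h₀st : s₀ ≤ t₀ := le_of_tendsto_of_tendsto' hs₀ ht₀ fun k ↦ hs't' (ψ k)
  have hcs₀ : c s₀ = b := by
    refine tendsto_nhds_unique (hkey hs₀) (tendsto_const_nhds.congr fun k ↦ ?_)
    rw [hφs, hsb]
  have hεlim : ε ≤ dist (c t₀) b := by
    refine ge_of_tendsto' ((hkey ht₀).dist tendsto_const_nhds) fun k ↦ ?_
    change ε ≤ dist (c' (ψ k) (φ (ψ k) (t' (ψ k)))) b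
    rw [hφt]
    exact hε (ψ k)
  exact ⟨c, rfl, s₀, t₀, h₀st, hcs₀, hεlim⟩

/-- **The event "some representative visits `b` and is later off `b`" is Borel**: it is the
countable union over `ε = 1/(n+1)` of the closed events
`isClosed_setOf_visits_then_dist_ge`. [cite: AizenmanBurchard1999, §2.1] -/
theorem measurableSet_setOf_visits_then_ne (b : E) :
    MeasurableSet {γ : CurveClass E | ∃ c : Curve E, CurveClass.mk c = γ ∧ ∃ s t : I, s ≤ t ∧
      c s = b ∧ c t ≠ b} := by
  have heq : {γ : CurveClass E | ∃ c : Curve E, CurveClass.mk c = γ ∧ ∃ s t : I, s ≤ t ∧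
      c s = b ∧ c t ≠ b} = ⋃ n : ℕ, {γ : CurveClass E | ∃ c : Curve E, CurveClass.mk c = γ ∧
        ∃ s t : I, s ≤ t ∧ c s = b ∧ 1 / ((n : ℝ) + 1) ≤ dist (c t) b} := by
    ext γ
    simp only [mem_setOf_eq, mem_iUnion]
    constructor
    · rintro ⟨c, hc, s, t, hst, hs, ht⟩
      obtain ⟨n, hn⟩ := exists_nat_one_div_lt (dist_pos.2 ht)
      exact ⟨n, c, hc, s, t, hst, hs, hn.le⟩
    · rintro ⟨n, c, hc, s, t, hst, hs, hn⟩
      refine ⟨c, hc, s, t, hst, hs, fun h ↦ ?_⟩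
      rw [h, dist_self] at hn
      exact absurd hn (not_le.2 (by positivity))
  rw [heq]
  exact MeasurableSet.iUnion fun n ↦
    (isClosed_setOf_visits_then_dist_ge b _).measurableSet

/-- The complementary event, "every representative stays at `b` after any visit of `b`", is Borel.
[cite: AizenmanBurchard1999, §2.1] -/
theorem measurableSet_setOf_forall_apply_eq (b : E) :
    MeasurableSet {γ : CurveClass E | ∀ c : Curve E, CurveClass.mk c = γ →
      ∀ s t : I, s ≤ t → c s = b → c t = b} := by
  convert (measurableSet_setOf_visits_then_ne b).compl using 1
  ext γ
  simp only [mem_setOf_eq, mem_compl_iff, not_exists, not_and, not_not]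

end CurveClass

/-! ### The SLE statement -/

section SLE

variable {κ : ℝ≥0} {D : DobrushinDomain}

/-- **The compactified image of the SLE trace takes the value `b` only at parameter `1`**: for
`s < 1`, `c₀ s = Φ(γ(s/(1-s)))` with `γ(·) ∈ ℍ̄`, and the boundary extension `Φ` of a chordal
uniformizing map omits `b` on `ℍ̄` (Carathéodory). [cite: PommerenkeBBCM1992, Thm. 2.6] -/
theorem eq_one_of_isCompactifiedImage_of_apply_eq
    {φ : ConformalEquiv UpperHalfPlane.upperHalfPlaneSet D.carrier} (hφ : D.IsChordalUniformizing φ)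
    {γ : ℝ≥0 → ℂ} (hγ : ∀ τ, 0 ≤ (γ τ).im) {c₀ : Curve ℂ}
    (h : IsCompactifiedImage φ.boundaryExtension γ (D.pt 1) c₀) {u : I} (hu : c₀ u = D.pt 1) :
    u = 1 := by
  by_contra hne
  have hu1 : (u : ℝ) < 1 := lt_of_le_of_ne u.2.2 fun h' ↦ hne (Subtype.ext h')
  rw [h.1 u hu1] at hu
  exact MarkedDomain.boundaryExtension_ne_pt_one JordanDomain.exists_continuousOn_extension_holds hφ
    (hγ _) hu

/-- **An SLE_κ random curve reaches its target only at the end** (random-curve level): almost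
surely, every representative `c` of the class `Γ ω` satisfies `c s = b → c t = b` for `s ≤ t`.
[cite: RohdeSchramm2005, Thm 7.1] -/
theorem ae_forall_apply_eq_pt_one_of_isSLECurve {Γ : (ℝ≥0 → ℝ) → CurveClass ℂ}
    (hΓ : IsSLECurve κ D Γ) :
    ∀ᵐ ω ∂Literature.Probability.Process.preWienerMeasure, ∀ c : Curve ℂ,
      CurveClass.mk c = Γ ω → ∀ s t : I, s ≤ t → c s = D.pt 1 → c t = D.pt 1 := by
  obtain ⟨-, φ, hφ, hae⟩ := hΓ
  filter_upwards [hae] with ω hω c hc s t hst hs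
  obtain ⟨hgen, c₀, hc₀, himg⟩ := hω
  have h0 : dist c c₀ = 0 := CurveClass.mk_eq_mk_iff_dist_eq_zero.1 (hc.trans hc₀)
  exact curve_apply_eq_of_dist_eq_zero h0
    (fun u hu ↦ eq_one_of_isCompactifiedImage_of_apply_eq hφ hgen.im_nonneg himg hu) himg.2 hst hs

/-- **A chordal SLE_κ law reaches its target only at the end** (law level, any `κ`): `μ`-a.e.
class has all its representatives staying at `b = D.pt 1` after any visit of `b`. The event is
Borel (`measurableSet_setOf_forall_apply_eq`), so the random-curve statement passes to
the law by `ae_map_iff`. [cite: RohdeSchramm2005, Thm 7.1] -/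
theorem ae_forall_apply_eq_pt_one_of_isSLELaw {μ : Measure (CurveClass ℂ)} (hμ : IsSLELaw κ D μ) :
    ∀ᵐ γ ∂μ, ∀ c : Curve ℂ, CurveClass.mk c = γ →
      ∀ s t : I, s ≤ t → c s = D.pt 1 → c t = D.pt 1 := by
  obtain ⟨Γ, hΓ, rfl⟩ := hμ
  exact (ae_map_iff hΓ.1 (measurableSet_setOf_forall_apply_eq (D.pt 1))).2
    (ae_forall_apply_eq_pt_one_of_isSLECurve hΓ)

/-- **Stub `stub_sleNoEarlyTarget` (line `germ-label-transport`).** Chordal SLE₆ reaches its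
target only at the end: no representative of a typical class visits `b = D.pt 1` and then leaves
it. [cite: RohdeSchramm2005, Thm 7.1] -/
theorem stub_sleNoEarlyTarget :
    ∀ (D : DobrushinDomain) (μ : MeasureTheory.Measure (CurveClass ℂ)), IsSLELaw 6 D μ →
      ∀ᵐ γ ∂μ, ∀ c : Curve ℂ, CurveClass.mk c = γ →
        ∀ s t : unitInterval, s ≤ t → c s = D.pt 1 → c t = D.pt 1 :=
  fun _ _ hμ ↦ ae_forall_apply_eq_pt_one_of_isSLELaw hμ

end SLE

end Summit.CriticalPhenomena.CardyFormulaZ2.Theorems.CardyRotToConfR2SymmetryUpgrade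

end
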